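import Mathlib
import HarnessLib
import Summits.Ventures.LatticeQCDFlow.Scoring.EmpiricalErrorBar

/-!
# The plug-in variance of a Doeblin chain is certified: from ANY start,
# `P(|V̂_N − Var_π f| > r₂ + 2C r₁) ≤ 2η` with data-free Hoeffding radii `r₁, r₂`

HONEST FRAMING: exact (Metropolis-corrected) sampling algorithms for lattice gauge theory;
figures of merit are autocorrelation/cost numbers at stated couplings and volumes; no
continuum-physics claim.

Venture `LatticeQCDFlow` (cell pub-lqcd), topic `Scoring`; FANOUT row 8 (`s0-cpn-nemc`, GEN-14).
NEW WORK of the cell, not a published result; no definition is introduced.  The two-sided version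
of the deterministic step inside `Scoring/EmpiricalErrorBar.lean`: the plug-in variance
`V̂_N = (1/N)Σ f(X_i)² − A_N²` of one run is within `Δ = r₂ + 2C r₁` of `Var_π f` whenever the time
averages of `f` and `f²` are within their certified Hoeffding radii of `πf`, `πf²`
(`Scoring/ChainConfidenceInterval.chain_confidence_of_doeblin`, any start) — so every quantity a
run prints that is built from `V̂_N` (effective sample sizes, the error bars of
`Scoring/NaiveErrorBar.lean` / `Scoring/BatchMeans.lean`) inherits a certified input.  Nothing is
cited as a fact.

## Content (`κ` Markov, `π` invariant, `κ(x, ·) ≥ ε π`, `ε > 0`, `e = ε.toReal`; `|f| ≤ C`; any `μ₀`;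
## `N ≥ 1`; `0 < η ≤ 1`, `L = log(2/η)`; `r₁ = 8C/(eN) + √(32C²L/(e²N))`,
## `r₂ = 8C²/(eN) + √(32C⁴L/(e²N))`)

* `abs_plugin_sub_variance_le` — deterministic: `|A − m| ≤ r₁`, `|Q − q| ≤ r₂`, `|A|, |m| ≤ C` ⇒
  `|(Q − A²) − (q − m²)| ≤ r₂ + 2C r₁`;
* **`chain_pluginVariance_of_doeblin`** —
  `P_{μ₀}(r₂ + 2C r₁ < |V̂_N − Var_π f|) ≤ 2η`.

NOT CLAIMED: any `ε` for a concrete sampler; variance-sensitive radii for `V̂_N` itself; unbounded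
observables.
-/

noncomputable section

namespace Summit.Ventures.LatticeQCDFlow.Scoring

open MeasureTheory ProbabilityTheory Filter Finset
open scoped ENNReal

variable {Ω : Type*} [MeasurableSpace Ω]

omit [MeasurableSpace Ω] in
/-- Deterministic two-sided step: `|(Q − A²) − (q − m²)| ≤ r₂ + 2 C r₁`. -/
theorem abs_plugin_sub_variance_le {A Q m q r₁ r₂ C : ℝ} (hA : |A - m| ≤ r₁) (hQ : |Q - q| ≤ r₂)
    (hAC : |A| ≤ C) (hmC : |m| ≤ C) : |(Q - A ^ 2) - (q - m ^ 2)| ≤ r₂ + 2 * C * r₁ := by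
  have h2 : |A ^ 2 - m ^ 2| ≤ 2 * C * r₁ := by
    rw [show A ^ 2 - m ^ 2 = (A - m) * (A + m) by ring, abs_mul]
    calc |A - m| * |A + m| ≤ r₁ * (2 * C) :=
          mul_le_mul hA ((abs_add_le _ _).trans (by linarith)) (abs_nonneg _)
            ((abs_nonneg _).trans hA)
      _ = 2 * C * r₁ := by ring
  calc |(Q - A ^ 2) - (q - m ^ 2)| = |(Q - q) - (A ^ 2 - m ^ 2)| := by ring_nf
    _ ≤ |Q - q| + |A ^ 2 - m ^ 2| := abs_sub _ _
    _ ≤ r₂ + 2 * C * r₁ := add_le_add hQ h2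

section Chain

variable {κ : Kernel Ω Ω} [IsMarkovKernel κ] {μ₀ : Measure Ω} [IsProbabilityMeasure μ₀]
  {π : Measure Ω} [IsProbabilityMeasure π] {ε : ℝ≥0∞}

/-- **THE PLUG-IN VARIANCE IS CERTIFIED, FROM ANY START.**  With `π` invariant, `κ(x, ·) ≥ ε π`
(`ε > 0`), `|f| ≤ C`, `N ≥ 1`, `0 < η ≤ 1` and the data-free radii `r₁, r₂` of the module docstring:
`P_{μ₀}(r₂ + 2C r₁ < |V̂_N − Var_π f|) ≤ 2η`. -/
theorem chain_pluginVariance_of_doeblin (hπ : Kernel.Invariant κ π)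
    (hmin : ∀ x {B : Set Ω}, MeasurableSet B → ε * π B ≤ κ x B) (hε0 : 0 < ε)
    {f : Ω → ℝ} (hf : Measurable f) {C : ℝ} (hC : ∀ x, |f x| ≤ C) {N : ℕ} (hN : N ≠ 0)
    {η : ℝ} (hη0 : 0 < η) (hη1 : η ≤ 1) :
    (Kernel.trajMeasure (X := fun _ : ℕ => Ω) μ₀
          (fun m : ℕ => κ.comap (fun y : (i : ↥(Finset.Iic m)) → Ω => y ⟨m, Finset.mem_Iic.2 le_rfl⟩)
            (measurable_pi_apply _))).real
        {x | (8 * C ^ 2 / (ε.toReal * N)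
                + Real.sqrt (32 * C ^ 4 * Real.log (2 / η) / (ε.toReal ^ 2 * N)))
              + 2 * C * (8 * C / (ε.toReal * N)
                + Real.sqrt (32 * C ^ 2 * Real.log (2 / η) / (ε.toReal ^ 2 * N)))
            < |((∑ i ∈ Finset.range N, f (x i) ^ 2) / N - ((∑ i ∈ Finset.range N, f (x i)) / N) ^ 2)
                - autocov κ π (fun y => f y - ∫ z, f z ∂π) 0|}
      ≤ 2 * η := by
  set P := Kernel.trajMeasure (X := fun _ : ℕ => Ω) μ₀
      (fun m : ℕ => κ.comap (fun y : (i : ↥(Finset.Iic m)) → Ω => y ⟨m, Finset.mem_Iic.2 le_rfl⟩)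
        (measurable_pi_apply _)) with hP
  set e := ε.toReal with he
  set m := ∫ z, f z ∂π with hm
  set q := ∫ z, f z ^ 2 ∂π with hq
  set L := Real.log (2 / η) with hL
  have hf2m : Measurable fun y => f y ^ 2 := hf.pow_const 2
  have hC0 : 0 ≤ C := by
    obtain ⟨x⟩ := nonempty_of_isProbabilityMeasure π
    exact (abs_nonneg _).trans (hC x)
  have hf2b : ∀ y, |f y ^ 2| ≤ C ^ 2 := fun y => by
    rw [abs_pow]; exact pow_le_pow_left₀ (abs_nonneg _) (hC y) 2
  have hmC : |m| ≤ C := by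
    rw [hm]
    calc |∫ z, f z ∂π| = ‖∫ z, f z ∂π‖ := (Real.norm_eq_abs _).symm
      _ ≤ C * π.real Set.univ := norm_integral_le_of_norm_le_const (Eventually.of_forall fun y => by
          rw [Real.norm_eq_abs]; exact hC y)
      _ = C := by rw [probReal_univ, mul_one]
  have hqC : |q| ≤ C ^ 2 := by
    rw [hq]
    calc |∫ z, f z ^ 2 ∂π| = ‖∫ z, f z ^ 2 ∂π‖ := (Real.norm_eq_abs _).symm
      _ ≤ C ^ 2 * π.real Set.univ := norm_integral_le_of_norm_le_const
          (Eventually.of_forall fun y => by rw [Real.norm_eq_abs]; exact hf2b y)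
      _ = C ^ 2 := by rw [probReal_univ, mul_one]
  obtain ⟨-, -, -, -, -, hεr0⟩ := half_const_bounds hmin hε0
  rw [← he] at hεr0
  have hNpos : (0 : ℝ) < N := by exact_mod_cast Nat.pos_of_ne_zero hN
  have hL0 : 0 ≤ L := Real.log_nonneg (by rw [le_div_iff₀ hη0]; linarith)
  set ρ₁ := 4 * (C + |m|) / (e * N) + Real.sqrt (8 * (C + |m|) ^ 2 * L / (e ^ 2 * N)) with hρ₁
  set ρ₂ := 4 * (C ^ 2 + |q|) / (e * N) + Real.sqrt (8 * (C ^ 2 + |q|) ^ 2 * L / (e ^ 2 * N)) with hρ₂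
  set r₁ := 8 * C / (e * N) + Real.sqrt (32 * C ^ 2 * L / (e ^ 2 * N)) with hr₁
  set r₂ := 8 * C ^ 2 / (e * N) + Real.sqrt (32 * C ^ 4 * L / (e ^ 2 * N)) with hr₂
  have hρr₁ : ρ₁ ≤ r₁ := by
    have h1 : 4 * (C + |m|) / (e * N) ≤ 8 * C / (e * N) :=
      div_le_div_of_nonneg_right (by linarith) (by positivity)
    have h2 : 8 * (C + |m|) ^ 2 * L / (e ^ 2 * N) ≤ 32 * C ^ 2 * L / (e ^ 2 * N) := by
      refine div_le_div_of_nonneg_right ?_ (by positivity)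
      have : (C + |m|) ^ 2 ≤ (2 * C) ^ 2 := pow_le_pow_left₀ (by positivity) (by linarith) 2
      nlinarith
    exact add_le_add h1 (Real.sqrt_le_sqrt h2)
  have hρr₂ : ρ₂ ≤ r₂ := by
    have h1 : 4 * (C ^ 2 + |q|) / (e * N) ≤ 8 * C ^ 2 / (e * N) :=
      div_le_div_of_nonneg_right (by linarith) (by positivity)
    have h2 : 8 * (C ^ 2 + |q|) ^ 2 * L / (e ^ 2 * N) ≤ 32 * C ^ 4 * L / (e ^ 2 * N) := by
      refine div_le_div_of_nonneg_right ?_ (by positivity)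
      have : (C ^ 2 + |q|) ^ 2 ≤ (2 * C ^ 2) ^ 2 := pow_le_pow_left₀ (by positivity) (by linarith) 2
      nlinarith
    exact add_le_add h1 (Real.sqrt_le_sqrt h2)
  have hB1 : P.real {x | ρ₁ < |(∑ i ∈ Finset.range N, f (x i)) / N - m|} ≤ η := by
    rw [hP, hρ₁, he, hm, hL]
    exact chain_confidence_of_doeblin (μ₀ := μ₀) hπ hmin hε0 hf hC hN hη0 hη1
  have hB2 : P.real {x | ρ₂ < |(∑ i ∈ Finset.range N, f (x i) ^ 2) / N - q|} ≤ η := by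
    rw [hP, hρ₂, he, hq, hL]
    exact chain_confidence_of_doeblin (μ₀ := μ₀) hπ hmin hε0 hf2m hf2b hN hη0 hη1
  have hσ : autocov κ π (fun y => f y - m) 0 = q - m ^ 2 := by
    rw [hq, hm]; exact variance_eq_integral_sq_sub κ hf hC
  have hsub : {x : ℕ → Ω | r₂ + 2 * C * r₁
        < |((∑ i ∈ Finset.range N, f (x i) ^ 2) / N - ((∑ i ∈ Finset.range N, f (x i)) / N) ^ 2)
            - autocov κ π (fun y => f y - m) 0|}
      ⊆ {x | ρ₁ < |(∑ i ∈ Finset.range N, f (x i)) / N - m|}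
        ∪ {x | ρ₂ < |(∑ i ∈ Finset.range N, f (x i) ^ 2) / N - q|} := by
    intro x hx
    by_contra hgood
    simp only [Set.mem_union, Set.mem_setOf_eq, not_or, not_lt] at hgood
    obtain ⟨hg1, hg2⟩ := hgood
    have hAx : |(∑ i ∈ Finset.range N, f (x i)) / N| ≤ C := abs_timeAverage_le hC hN x
    have hdet := abs_plugin_sub_variance_le (hg1.trans hρr₁) (hg2.trans hρr₂) hAx hmC
    rw [← hσ] at hdet
    exact absurd hx (not_lt.2 hdet)
  calc P.real _ ≤ P.real ({x | ρ₁ < |(∑ i ∈ Finset.range N, f (x i)) / N - m|}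
          ∪ {x | ρ₂ < |(∑ i ∈ Finset.range N, f (x i) ^ 2) / N - q|}) := measureReal_mono hsub
    _ ≤ P.real {x | ρ₁ < |(∑ i ∈ Finset.range N, f (x i)) / N - m|}
          + P.real {x | ρ₂ < |(∑ i ∈ Finset.range N, f (x i) ^ 2) / N - q|} :=
        measureReal_union_le _ _
    _ ≤ η + η := add_le_add hB1 hB2
    _ = 2 * η := by ring

end Chain

end Summit.Ventures.LatticeQCDFlow.Scoring

end
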